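import Mathlib

/-!
# Route OverlapGapAlgebra, crux `SolvableImpliesStableSection` (stmt-PneNP-2463), line `Sketch`:
# Stub 1 `stub_walkAvoidsBad` — the Bresler–Huang walk lemma (arXiv:2106.02129, Lemma 6.5), counting form

Lazy coordinate-resampling walk on `J → S` (`|S| ≥ 2`): schedule `σ : Fin T → J`, start `v`, fresh
symbols `U : Fin T → S` (step `t` overwrites coordinate `σ t` with `U t`; positions `pos`, specified by
`hpos0`/`hposS` only), `Bad` an arbitrary SYMMETRIC relation (bad edges); a step is harmless if it is
lazy (`U t` is the current symbol) or its edge is not bad. **Theorem.** `#{(v, U) : all steps harmless}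
≥ |S|^{|J|+T}·exp(-(log|S|/((|S|-1)|S|^{|J|}))·∑_t bp(σ t))`, `bp j = #{(v, s) : s ≠ v j, Bad v (v[j↦s])}`,
i.e. the walk avoids all bad edges with probability `≥ |S|^{-∑_t λ_{σ t}}` (`λ_j` = bad-edge fraction).
Proof (BH §6.2, after Gamarnik–Jagannath–Wein): `q_{T+1}(v) = |S|⁻¹∑_s [s = v j ∨ ¬Bad]·q_T(v[j↦s])`
(`wab_decomp`, `wab_card_decomp`), two Jensens for `log` and a symmetrisation over the involution
`(v,s) ↦ (v[j↦s], v j)` (`wab_step_ineq`: `∑_v log q_{T+1} ≥ ∑_v log q_T - (log|S|/(|S|-1))·bp(j)`),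
induction on `T` (`wab_main`), a final Jensen; positivity from the all-lazy continuation. No definitions.
-/

set_option linter.dupNamespace false -- `Summit.PneNP.PneNP.…`: summit = sub-problem (D-0017)

namespace Summit.PneNP.PneNP.Cruxes.SolvableImpliesStableSection.Sketch

open Finset
open scoped Classical

section WalkLemma

variable {S J : Type*} [DecidableEq J]

/-- Every start has a good symbol sequence (the all-lazy one `t ↦ v (σ t)`, which keeps the walk at
`v`), so the number of good `U` from `v` is positive. -/
private theorem wab_card_pos [Fintype S] [DecidableEq S] (T : ℕ) (σ : Fin T → J)
    (Bad : (J → S) → (J → S) → Prop) (pos : (J → S) → (Fin T → S) → ℕ → (J → S))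
    (hpos0 : ∀ v U, pos v U 0 = v)
    (hposS : ∀ v U (t : Fin T), pos v U ((t : ℕ) + 1) = Function.update (pos v U t) (σ t) (U t))
    (v : J → S) : 0 < ((univ : Finset (Fin T → S)).filter fun U =>
      ∀ t : Fin T, U t = pos v U t (σ t) ∨ ¬ Bad (pos v U t) (pos v U ((t : ℕ) + 1))).card := by
  have hlazy : ∀ t : ℕ, t ≤ T → pos v (fun t => v (σ t)) t = v := by
    intro t
    induction t with
    | zero => intro _; exact hpos0 _ _
    | succ t ih =>
      intro ht
      have h := hposS v (fun t => v (σ t)) ⟨t, ht⟩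
      simp only at h
      rw [h, ih (Nat.le_of_succ_le ht), Function.update_eq_self]
  exact Finset.card_pos.2 ⟨fun t => v (σ t), by
    simpa only [mem_filter, mem_univ, true_and] using fun t => Or.inl (by rw [hlazy t t.isLt.le])⟩

/-- Two walks driven by the same symbols that agree at time `1` agree at all times `1, …, T`. -/
private theorem wab_agree (T : ℕ) (σ : Fin T → J) (pos : (J → S) → (Fin T → S) → ℕ → (J → S))
    (hposS : ∀ v U (t : Fin T), pos v U ((t : ℕ) + 1) = Function.update (pos v U t) (σ t) (U t))
    (v w : J → S) (U : Fin T → S) (h1 : pos v U 1 = pos w U 1) :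
    ∀ t : ℕ, t + 1 ≤ T → pos v U (t + 1) = pos w U (t + 1) := by
  intro t
  induction t with
  | zero => intro _; exact h1
  | succ t ih =>
    intro ht
    have hv := hposS v U ⟨t + 1, ht⟩
    have hw := hposS w U ⟨t + 1, ht⟩
    simp only at hv hw
    rw [hv, hw, ih (Nat.le_of_succ_le ht)]

/-- One step of the walk: `Fin.cons s U'` is good from `v` for the schedule `σ` iff the first step is
harmless (`s = v (σ 0)` or the edge to `v[σ 0 ↦ s]` is not bad) and `U'` is good for the REMAINING
walk, read off the same position function from the new start `v[σ 0 ↦ s]`. -/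
private theorem wab_decomp (T : ℕ) (σ : Fin (T + 1) → J) (Bad : (J → S) → (J → S) → Prop)
    (pos : (J → S) → (Fin (T + 1) → S) → ℕ → (J → S)) (hpos0 : ∀ v U, pos v U 0 = v)
    (hposS : ∀ v U (t : Fin (T + 1)), pos v U ((t : ℕ) + 1) = Function.update (pos v U t) (σ t) (U t))
    (v : J → S) (s : S) (U' : Fin T → S) :
    (∀ t : Fin (T + 1), (Fin.cons s U' : Fin (T + 1) → S) t = pos v (Fin.cons s U') t (σ t) ∨
        ¬ Bad (pos v (Fin.cons s U') t) (pos v (Fin.cons s U') ((t : ℕ) + 1))) ↔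
      ((s = v (σ 0) ∨ ¬ Bad v (Function.update v (σ 0) s)) ∧
        ∀ t : Fin T, U' t = pos (Function.update v (σ 0) s) (Fin.cons s U') ((t : ℕ) + 1) (σ t.succ) ∨
          ¬ Bad (pos (Function.update v (σ 0) s) (Fin.cons s U') ((t : ℕ) + 1))
            (pos (Function.update v (σ 0) s) (Fin.cons s U') ((t : ℕ) + 1 + 1))) := by
  have hstart : pos v (Fin.cons s U') 1 = Function.update v (σ 0) s := by
    simpa only [Fin.val_zero, zero_add, hpos0, Fin.cons_zero] using hposS v (Fin.cons s U') 0
  have h1 : pos v (Fin.cons s U') 1 = pos (Function.update v (σ 0) s) (Fin.cons s U') 1 := by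
    have hw := hposS (Function.update v (σ 0) s) (Fin.cons s U') 0
    simp only [Fin.val_zero, zero_add, hpos0, Fin.cons_zero, Function.update_idem] at hw
    rw [hstart, hw]
  have hagree := wab_agree (T + 1) σ pos hposS v (Function.update v (σ 0) s) (Fin.cons s U') h1
  rw [Fin.forall_fin_succ]
  simp only [Fin.cons_zero, Fin.cons_succ, Fin.val_zero, Fin.val_succ, hpos0, zero_add]
  rw [hstart]
  refine and_congr Iff.rfl (forall_congr' fun t => ?_)
  rw [hagree t (by have := t.isLt; omega), hagree (t + 1) (by have := t.isLt; omega)]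

/-! ### The analytic step: two Jensens and a symmetrisation -/

/-- Pointwise lower bound for `log q(v)` after the lazy one-step decomposition (Jensen twice): with
`N = |S|`, `x = N⁻¹ ∑_s [s = v j ∨ ¬Bad(v, v[j↦s])] q'(v[j↦s])` is the average over `s ≠ v j` of
`N⁻¹ q'(v) + (1 - N⁻¹)[¬Bad] q'(v[j↦s])`, whose log is at least `log q'(v) - log N` on a bad edge and
at least `N⁻¹ log q'(v) + (1-N⁻¹) log q'(v[j↦s])` otherwise. -/
private theorem wab_pointwise [Fintype S] [DecidableEq S] (hS : 2 ≤ Fintype.card S) (j : J)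
    (Bad : (J → S) → (J → S) → Prop) (q' : (J → S) → ℝ) (hq' : ∀ w, 0 < q' w) (v : J → S) (x : ℝ)
    (hx : x = (Fintype.card S : ℝ)⁻¹ *
      ∑ s, if s = v j ∨ ¬ Bad v (Function.update v j s) then q' (Function.update v j s) else 0) :
    ((Fintype.card S : ℝ) - 1)⁻¹ * ∑ s ∈ univ.erase (v j),
        (if Bad v (Function.update v j s) then Real.log (q' v) - Real.log (Fintype.card S)
         else (Fintype.card S : ℝ)⁻¹ * Real.log (q' v) +
           (1 - (Fintype.card S : ℝ)⁻¹) * Real.log (q' (Function.update v j s)))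
      ≤ Real.log x := by
  set N : ℝ := (Fintype.card S : ℝ) with hN
  have hN2 : (2 : ℝ) ≤ N := by rw [hN]; exact_mod_cast hS
  have hN1 : (0 : ℝ) < N - 1 := by linarith
  have hNinv0 : (0 : ℝ) < N⁻¹ := inv_pos.2 (by linarith)
  have hNinv1 : (0 : ℝ) ≤ 1 - N⁻¹ := sub_nonneg.2 (inv_le_one_of_one_le₀ (by linarith))
  have hcardE : ((univ.erase (v j)).card : ℝ) = N - 1 := by
    rw [Finset.card_erase_of_mem (mem_univ _), Finset.card_univ, Nat.cast_sub, Nat.cast_one, hN]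
    exact le_trans (by norm_num) hS
  -- the averaged quantities `X s > 0`
  set X : S → ℝ := fun s => N⁻¹ * q' v +
    (1 - N⁻¹) * (if ¬ Bad v (Function.update v j s) then q' (Function.update v j s) else 0) with hXdef
  have hXpos : ∀ s, 0 < X s := by
    intro s
    have h1 : 0 < N⁻¹ * q' v := mul_pos hNinv0 (hq' v)
    have h2 : 0 ≤ (1 - N⁻¹) *
        (if ¬ Bad v (Function.update v j s) then q' (Function.update v j s) else 0) :=
      mul_nonneg hNinv1 (by split_ifs <;> first | exact (hq' _).le | exact le_rfl)
    simp only [hXdef]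
    linarith
  -- (1) `x` is the average of `X` over `s ≠ v j`
  have hsum : (∑ s, if s = v j ∨ ¬ Bad v (Function.update v j s) then q' (Function.update v j s)
      else 0) = q' v + ∑ s ∈ univ.erase (v j),
        (if ¬ Bad v (Function.update v j s) then q' (Function.update v j s) else 0) := by
    rw [← Finset.add_sum_erase univ _ (mem_univ (v j))]
    congr 1
    · simp [Function.update_eq_self]
    · exact Finset.sum_congr rfl fun s hs => by simp [Finset.ne_of_mem_erase hs]
  have hxavg : x = (N - 1)⁻¹ * ∑ s ∈ univ.erase (v j), X s := by
    rw [hx, hsum]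
    simp only [hXdef, Finset.sum_add_distrib, Finset.sum_const, nsmul_eq_mul, hcardE,
      ← Finset.mul_sum]
    field_simp
  -- (2) Jensen over `s ≠ v j`
  have hJ1 : ∑ s ∈ univ.erase (v j), (N - 1)⁻¹ • Real.log (X s) ≤
      Real.log (∑ s ∈ univ.erase (v j), (N - 1)⁻¹ • X s) := by
    refine (strictConcaveOn_log_Ioi.concaveOn).le_map_sum (fun _ _ => (inv_pos.2 hN1).le) ?_
      (fun s _ => hXpos s)
    rw [Finset.sum_const, nsmul_eq_mul, hcardE, mul_inv_cancel₀ hN1.ne']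
  have hJ1' : (N - 1)⁻¹ * ∑ s ∈ univ.erase (v j), Real.log (X s) ≤ Real.log x := by
    rw [hxavg, Finset.mul_sum]
    simpa only [smul_eq_mul, ← Finset.mul_sum] using hJ1
  -- (3) the two-point bound for each `s`, and the conclusion
  refine le_trans (mul_le_mul_of_nonneg_left (Finset.sum_le_sum fun s _ => ?_) (inv_pos.2 hN1).le) hJ1'
  by_cases hb : Bad v (Function.update v j s)
  · simp only [hb, if_true, hXdef, not_true_eq_false, if_false, mul_zero, add_zero]
    rw [Real.log_mul hNinv0.ne' (hq' v).ne', Real.log_inv]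
    linarith
  · simp only [hb, if_false, hXdef, not_false_eq_true, if_true]
    simpa only [smul_eq_mul] using (strictConcaveOn_log_Ioi.concaveOn).2 (hq' v)
      (hq' (Function.update v j s)) hNinv0.le hNinv1 (by ring)

/-- The one-step inequality `∑_v log q(v) ≥ ∑_v log q'(v) - (log|S|/(|S|-1)) · bp(j)`: sum the
pointwise bound over `v`, re-index the double sum over the ordered pairs `(v, s)`, `s ≠ v j`, and
symmetrise with the involution `(v, s) ↦ (v[j↦s], v j)`; on a pair the two pointwise terms add up to
`log q'(v) + log q'(v[j↦s]) - 2·[Bad]·log|S|` exactly (by the symmetry of `Bad`). -/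
private theorem wab_step_ineq [Fintype S] [Fintype J] [DecidableEq S] (hS : 2 ≤ Fintype.card S)
    (j : J) (Bad : (J → S) → (J → S) → Prop) (hsymm : ∀ v w, Bad v w → Bad w v)
    (q q' : (J → S) → ℝ) (hq' : ∀ w, 0 < q' w)
    (hq : ∀ v, q v = (Fintype.card S : ℝ)⁻¹ *
      ∑ s, if s = v j ∨ ¬ Bad v (Function.update v j s) then q' (Function.update v j s) else 0) :
    ∑ v, Real.log (q' v) - Real.log (Fintype.card S) / ((Fintype.card S : ℝ) - 1) *
        (((univ : Finset ((J → S) × S)).filter fun p =>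
          p.2 ≠ p.1 j ∧ Bad p.1 (Function.update p.1 j p.2)).card : ℝ)
      ≤ ∑ v, Real.log (q v) := by
  set N : ℝ := (Fintype.card S : ℝ) with hN
  have hN2 : (2 : ℝ) ≤ N := by rw [hN]; exact_mod_cast hS
  have hN1 : (0 : ℝ) < N - 1 := by linarith
  -- the pointwise terms `Y v s`, the ordered pairs `P`, the involution `ι`
  set Y : (J → S) → S → ℝ := fun v s =>
    if Bad v (Function.update v j s) then Real.log (q' v) - Real.log N
    else N⁻¹ * Real.log (q' v) + (1 - N⁻¹) * Real.log (q' (Function.update v j s)) with hYdef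
  set P : Finset ((J → S) × S) := univ.filter fun p => p.2 ≠ p.1 j with hPdef
  set ι : (J → S) × S → (J → S) × S := fun p => (Function.update p.1 j p.2, p.1 j) with hιdef
  have hιP : ∀ p ∈ P, ι p ∈ P := fun p hp => by
    simp only [hPdef, mem_filter, mem_univ, true_and] at hp ⊢
    simpa [hιdef] using hp.symm
  have hιι : ∀ p ∈ P, ι (ι p) = p := fun p _ => by
    simp only [hιdef, Function.update_idem, Function.update_eq_self, Function.update_self]
  have hdouble : ∀ F : (J → S) → S → ℝ, ∑ v, ∑ s ∈ univ.erase (v j), F v s = ∑ p ∈ P, F p.1 p.2 := by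
    intro F
    rw [hPdef, Finset.sum_filter, Fintype.sum_prod_type]
    exact Finset.sum_congr rfl fun v _ => by rw [← Finset.filter_ne', Finset.sum_filter]
  -- (a) sum of the pointwise bounds
  have hA : (N - 1)⁻¹ * ∑ p ∈ P, Y p.1 p.2 ≤ ∑ v, Real.log (q v) := by
    rw [← hdouble, Finset.mul_sum]
    exact Finset.sum_le_sum fun v _ => wab_pointwise hS j Bad q' hq' v (q v) (hq v)
  -- (b) symmetrisation: `2 ∑_P Y = ∑_P (Y p + Y (ι p))`, computed pairwise
  have hsymY : ∑ p ∈ P, Y p.1 p.2 = ∑ p ∈ P, Y (ι p).1 (ι p).2 :=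
    Finset.sum_nbij' ι ι hιP hιP hιι hιι (fun p hp => by rw [hιι p hp])
  have hpair : ∀ p ∈ P, Y p.1 p.2 + Y (ι p).1 (ι p).2 =
      Real.log (q' p.1) + Real.log (q' (Function.update p.1 j p.2)) -
        2 * (if Bad p.1 (Function.update p.1 j p.2) then Real.log N else 0) := by
    intro p _
    have hback : Function.update (Function.update p.1 j p.2) j (p.1 j) = p.1 := by
      rw [Function.update_idem, Function.update_eq_self]
    by_cases hb : Bad p.1 (Function.update p.1 j p.2)
    · have hb' : Bad (Function.update p.1 j p.2) p.1 := hsymm _ _ hb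
      simp only [hYdef, hιdef, hback, hb, hb', if_true]
      ring
    · have hb' : ¬ Bad (Function.update p.1 j p.2) p.1 := fun h => hb (hsymm _ _ h)
      simp only [hYdef, hιdef, hback, hb, hb', if_false]
      ring
  have hB : 2 * ∑ p ∈ P, Y p.1 p.2 = ∑ p ∈ P, Real.log (q' p.1) +
      ∑ p ∈ P, Real.log (q' (Function.update p.1 j p.2)) -
        2 * ∑ p ∈ P, (if Bad p.1 (Function.update p.1 j p.2) then Real.log N else 0) := by
    rw [two_mul, show (∑ p ∈ P, Y p.1 p.2) + ∑ p ∈ P, Y p.1 p.2 =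
        ∑ p ∈ P, (Y p.1 p.2 + Y (ι p).1 (ι p).2) by rw [Finset.sum_add_distrib, ← hsymY],
      Finset.sum_congr rfl hpair, Finset.sum_sub_distrib, Finset.sum_add_distrib, Finset.mul_sum]
  -- (c) the three sums
  have hC1 : ∑ p ∈ P, Real.log (q' p.1) = (N - 1) * ∑ v, Real.log (q' v) := by
    rw [← hdouble (fun v _ => Real.log (q' v)), Finset.mul_sum]
    refine Finset.sum_congr rfl fun v _ => ?_
    rw [Finset.sum_const, nsmul_eq_mul, Finset.card_erase_of_mem (mem_univ _), Finset.card_univ,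
      Nat.cast_sub (le_trans (by norm_num) hS), Nat.cast_one, hN]
  have hC2 : ∑ p ∈ P, Real.log (q' (Function.update p.1 j p.2)) = ∑ p ∈ P, Real.log (q' p.1) :=
    Finset.sum_nbij' ι ι hιP hιP hιι hιι (fun p _ => by simp only [hιdef])
  have hC3 : ∑ p ∈ P, (if Bad p.1 (Function.update p.1 j p.2) then Real.log N else 0) =
      Real.log N * (((univ : Finset ((J → S) × S)).filter fun p =>
        p.2 ≠ p.1 j ∧ Bad p.1 (Function.update p.1 j p.2)).card : ℝ) := by
    rw [← Finset.sum_filter, Finset.sum_const, nsmul_eq_mul, mul_comm, hPdef, Finset.filter_filter]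
  -- (d) assemble
  rw [hC2, hC1, hC3] at hB
  have hfinal : (N - 1)⁻¹ * ∑ p ∈ P, Y p.1 p.2 = ∑ v, Real.log (q' v) - Real.log N / (N - 1) *
      (((univ : Finset ((J → S) × S)).filter fun p =>
        p.2 ≠ p.1 j ∧ Bad p.1 (Function.update p.1 j p.2)).card : ℝ) := by
    rw [show ∑ p ∈ P, Y p.1 p.2 = (N - 1) * ∑ v, Real.log (q' v) - Real.log N *
        (((univ : Finset ((J → S) × S)).filter fun p =>
          p.2 ≠ p.1 j ∧ Bad p.1 (Function.update p.1 j p.2)).card : ℝ) by linarith]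
    field_simp
  linarith [hA, hfinal]

/-! ### Counting and the induction -/

/-- Fibrewise count along `U ↦ (U 0, tail U)`: if `good (cons s U') ↔ c s ∧ good' s U'` then
`#{U : good U} = ∑_s [c s] · #{U' : good' s U'}`. -/
private theorem wab_card_decomp [Fintype S] (T : ℕ) (good : (Fin (T + 1) → S) → Prop)
    [DecidablePred good] (c : S → Prop) [DecidablePred c] (good' : S → (Fin T → S) → Prop)
    [∀ s, DecidablePred (good' s)] (h : ∀ s U', good (Fin.cons s U') ↔ (c s ∧ good' s U')) :
    (((univ : Finset (Fin (T + 1) → S)).filter good).card : ℝ) =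
      ∑ s, if c s then (((univ : Finset (Fin T → S)).filter (good' s)).card : ℝ) else 0 := by
  have hcount : ((univ : Finset (Fin (T + 1) → S)).filter good).card =
      ((univ : Finset (S × (Fin T → S))).filter fun p => c p.1 ∧ good' p.1 p.2).card := by
    refine (Finset.card_equiv (Fin.consEquiv fun _ : Fin (T + 1) => S) fun p => ?_).symm
    simp only [mem_filter, mem_univ, true_and]
    exact (h p.1 p.2).symm
  rw [hcount, Finset.card_filter, Fintype.sum_prod_type, Nat.cast_sum]
  refine Finset.sum_congr rfl fun s _ => ?_
  by_cases hc : c s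
  · simp only [hc, true_and, if_true, Finset.card_filter, Nat.cast_sum]
  · simp [hc]

/-- The induction (Bresler–Huang's `E log q ≥ -log|S| ∑ λ`, as a sum over starts):
`-(log|S|/(|S|-1)) ∑_t bp(σ t) ≤ ∑_v log (#{U good from v} / |S|^T)`. -/
private theorem wab_main [Fintype S] [Fintype J] [DecidableEq S] (hS : 2 ≤ Fintype.card S)
    (Bad : (J → S) → (J → S) → Prop) (hsymm : ∀ v w, Bad v w → Bad w v) :
    ∀ (T : ℕ) (σ : Fin T → J) (pos : (J → S) → (Fin T → S) → ℕ → (J → S)),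
      (∀ v U, pos v U 0 = v) →
      (∀ v U (t : Fin T), pos v U ((t : ℕ) + 1) = Function.update (pos v U t) (σ t) (U t)) →
      -(Real.log (Fintype.card S) / ((Fintype.card S : ℝ) - 1)) *
          ∑ t : Fin T, (((univ : Finset ((J → S) × S)).filter fun p =>
            p.2 ≠ p.1 (σ t) ∧ Bad p.1 (Function.update p.1 (σ t) p.2)).card : ℝ)
        ≤ ∑ v : J → S, Real.log ((((univ : Finset (Fin T → S)).filter fun U =>
            ∀ t : Fin T, U t = pos v U t (σ t) ∨
              ¬ Bad (pos v U t) (pos v U ((t : ℕ) + 1))).card : ℝ) / (Fintype.card S : ℝ) ^ T) := by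
  intro T
  induction T with
  | zero => intro σ pos _ _; simp
  | succ T ih =>
    intro σ pos hpos0 hposS
    set N : ℝ := (Fintype.card S : ℝ) with hN
    have hN0 : (0 : ℝ) < N := by rw [hN]; exact_mod_cast (by omega : 0 < Fintype.card S)
    -- the remaining walk: directions `σ ∘ succ`, positions read off `pos` one step later
    obtain ⟨pos', hpos'⟩ : ∃ pos' : (J → S) → (Fin T → S) → ℕ → (J → S),
        ∀ w U' t, pos' w U' t = pos w (Fin.cons (w (σ 0)) U') (t + 1) := ⟨_, fun _ _ _ => rfl⟩
    have hpos0' : ∀ w U', pos' w U' 0 = w := fun w U' => by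
      rw [hpos']
      simpa only [Fin.val_zero, zero_add, hpos0, Fin.cons_zero, Function.update_eq_self] using
        hposS w (Fin.cons (w (σ 0)) U') 0
    have hposS' : ∀ w U' (t : Fin T), pos' w U' ((t : ℕ) + 1) =
        Function.update (pos' w U' t) (σ t.succ) (U' t) := fun w U' t => by
      rw [hpos', hpos']
      simpa only [Fin.val_succ, Fin.cons_succ] using hposS w (Fin.cons (w (σ 0)) U') t.succ
    have hIH := ih (fun t => σ t.succ) pos' hpos0' hposS'
    -- the fractions `q` (length `T+1`) and `q'` (length `T`, remaining walk)
    set q' : (J → S) → ℝ := fun w => (((univ : Finset (Fin T → S)).filter fun U' =>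
      ∀ t : Fin T, U' t = pos' w U' t (σ t.succ) ∨
        ¬ Bad (pos' w U' t) (pos' w U' ((t : ℕ) + 1))).card : ℝ) / N ^ T with hq'def
    set q : (J → S) → ℝ := fun v => (((univ : Finset (Fin (T + 1) → S)).filter fun U =>
      ∀ t : Fin (T + 1), U t = pos v U t (σ t) ∨
        ¬ Bad (pos v U t) (pos v U ((t : ℕ) + 1))).card : ℝ) / N ^ (T + 1) with hqdef
    have hq'pos : ∀ w, 0 < q' w := fun w => by
      simp only [hq'def]
      exact div_pos (by exact_mod_cast wab_card_pos T (fun t => σ t.succ) Bad pos' hpos0' hposS' w)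
        (pow_pos hN0 T)
    -- the one-step decomposition of `q`
    have hq : ∀ v, q v = N⁻¹ * ∑ s, if s = v (σ 0) ∨ ¬ Bad v (Function.update v (σ 0) s)
        then q' (Function.update v (σ 0) s) else 0 := by
      intro v
      have hdec := wab_card_decomp T
        (fun U => ∀ t : Fin (T + 1), U t = pos v U t (σ t) ∨
          ¬ Bad (pos v U t) (pos v U ((t : ℕ) + 1)))
        (fun s => s = v (σ 0) ∨ ¬ Bad v (Function.update v (σ 0) s))
        (fun s U' => ∀ t : Fin T, U' t = pos' (Function.update v (σ 0) s) U' t (σ t.succ) ∨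
          ¬ Bad (pos' (Function.update v (σ 0) s) U' t)
            (pos' (Function.update v (σ 0) s) U' ((t : ℕ) + 1)))
        (fun s U' => by
          rw [wab_decomp T σ Bad pos hpos0 hposS v s U']
          simp only [hpos', Function.update_self])
      simp only [hqdef, hq'def]
      rw [hdec, pow_succ, Finset.mul_sum, Finset.sum_div]
      refine Finset.sum_congr rfl fun s _ => ?_
      split_ifs
      · field_simp
      · simp
    -- the analytic step and the induction hypothesis
    have hstep := wab_step_ineq hS (σ 0) Bad hsymm q q' hq'pos hq
    rw [Fin.sum_univ_succ, mul_add]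
    simp only [hq'def, hqdef] at hstep
    linarith [hstep, hIH]

end WalkLemma

/-- **Stub 1 of line `Sketch` — the walk lemma (Bresler–Huang, arXiv:2106.02129, Lemma 6.5), counting
form.** For symbols `S` (`|S| ≥ 2`), coordinates `J`, schedule `σ : Fin T → J`, a symmetric bad-edge
relation `Bad` on `J → S` and the lazy resampling walk `pos` (`hpos0`, `hposS`), the pairs `(v, U)` all of
whose steps are lazy or traverse a non-bad edge number at least
`|S|^{|J|+T} · exp(-(log|S| / ((|S|-1)|S|^{|J|})) · ∑_t bp(σ t))`, `bp j = #{(v,s) : s ≠ v j, Bad v (v[j↦s])}`: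
the walk from a uniform start avoids every bad edge with probability `≥ |S|^{-∑_t λ_{σ t}}`. -/
theorem stub_walkAvoidsBad {S J : Type*} [Fintype S] [Fintype J] [DecidableEq S] [DecidableEq J]
    (hS : 2 ≤ Fintype.card S) (T : ℕ) (σ : Fin T → J) (Bad : (J → S) → (J → S) → Prop)
    (hsymm : ∀ v w, Bad v w → Bad w v)
    (pos : (J → S) → (Fin T → S) → ℕ → (J → S))
    (hpos0 : ∀ v U, pos v U 0 = v)
    (hposS : ∀ v U (t : Fin T), pos v U ((t : ℕ) + 1) = Function.update (pos v U t) (σ t) (U t)) :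
    (Fintype.card S : ℝ) ^ (Fintype.card J + T) *
        Real.exp (-(Real.log (Fintype.card S) /
            ((Fintype.card S - 1 : ℝ) * (Fintype.card S : ℝ) ^ Fintype.card J) *
          ∑ t : Fin T, (((univ : Finset ((J → S) × S)).filter fun p =>
              p.2 ≠ p.1 (σ t) ∧ Bad p.1 (Function.update p.1 (σ t) p.2)).card : ℝ)))
      ≤ (((univ : Finset ((J → S) × (Fin T → S))).filter fun vU =>
          ∀ t : Fin T, vU.2 t = pos vU.1 vU.2 t (σ t) ∨
            ¬ Bad (pos vU.1 vU.2 t) (pos vU.1 vU.2 ((t : ℕ) + 1))).card : ℝ) := by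
  have hmain := wab_main hS Bad hsymm T σ pos hpos0 hposS
  set N : ℝ := (Fintype.card S : ℝ) with hN
  have hN2 : (2 : ℝ) ≤ N := by rw [hN]; exact_mod_cast hS
  have hN0 : (0 : ℝ) < N := by linarith
  set B : ℝ := ∑ t : Fin T, (((univ : Finset ((J → S) × S)).filter fun p =>
    p.2 ≠ p.1 (σ t) ∧ Bad p.1 (Function.update p.1 (σ t) p.2)).card : ℝ) with hB
  -- per-start fractions `a v > 0`, number of starts `V = N^{|J|}`
  set a : (J → S) → ℝ := fun v => (((univ : Finset (Fin T → S)).filter fun U =>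
    ∀ t : Fin T, U t = pos v U t (σ t) ∨
      ¬ Bad (pos v U t) (pos v U ((t : ℕ) + 1))).card : ℝ) / N ^ T with ha
  have hapos : ∀ v, 0 < a v := fun v =>
    div_pos (by exact_mod_cast wab_card_pos T σ Bad pos hpos0 hposS v) (pow_pos hN0 T)
  haveI : Nonempty S := Fintype.card_pos_iff.1 (by omega)
  set V : ℝ := (Fintype.card (J → S) : ℝ) with hVdef
  have hV : V = N ^ Fintype.card J := by rw [hVdef, Fintype.card_fun]; push_cast; rw [hN]
  have hV0 : 0 < V := by rw [hVdef]; exact_mod_cast Fintype.card_pos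
  -- the count is `N^T ∑_v a v`
  have hcount : (((univ : Finset ((J → S) × (Fin T → S))).filter fun vU =>
      ∀ t : Fin T, vU.2 t = pos vU.1 vU.2 t (σ t) ∨
        ¬ Bad (pos vU.1 vU.2 t) (pos vU.1 vU.2 ((t : ℕ) + 1))).card : ℝ) = N ^ T * ∑ v, a v := by
    rw [Finset.card_filter, Fintype.sum_prod_type, Nat.cast_sum, Finset.mul_sum]
    refine Finset.sum_congr rfl fun v _ => ?_
    simp only [ha]
    rw [mul_div_cancel₀ _ (pow_ne_zero T hN0.ne'), Finset.card_filter, Nat.cast_sum]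
  -- Jensen `avg log ≤ log avg`, then exponentiate
  have hJ : ∑ v, V⁻¹ • Real.log (a v) ≤ Real.log (∑ v, V⁻¹ • a v) := by
    refine (strictConcaveOn_log_Ioi.concaveOn).le_map_sum (fun _ _ => (inv_pos.2 hV0).le) ?_
      (fun v _ => hapos v)
    rw [Finset.sum_const, Finset.card_univ, nsmul_eq_mul, ← hVdef, mul_inv_cancel₀ hV0.ne']
  simp only [smul_eq_mul, ← Finset.mul_sum] at hJ
  have hsum_pos : 0 < ∑ v, a v := Finset.sum_pos (fun v _ => hapos v) Finset.univ_nonempty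
  have hlog : -(V⁻¹ * (Real.log N / (N - 1)) * B) ≤ Real.log (V⁻¹ * ∑ v, a v) := by
    refine le_trans ?_ hJ
    have := mul_le_mul_of_nonneg_left hmain (inv_pos.2 hV0).le
    simp only [ha] at this ⊢
    linarith
  have hexp : V * Real.exp (-(V⁻¹ * (Real.log N / (N - 1)) * B)) ≤ ∑ v, a v := by
    have h := mul_le_mul_of_nonneg_left
      ((Real.le_log_iff_exp_le (mul_pos (inv_pos.2 hV0) hsum_pos)).1 hlog) hV0.le
    rwa [← mul_assoc, mul_inv_cancel₀ hV0.ne', one_mul] at h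
  have hexpeq : Real.exp (-(Real.log N / ((N - 1) * N ^ Fintype.card J) * B)) =
      Real.exp (-(V⁻¹ * (Real.log N / (N - 1)) * B)) := by
    rw [hV]
    have hN1 : N - 1 ≠ 0 := by linarith
    have hNJ : N ^ Fintype.card J ≠ 0 := pow_ne_zero _ hN0.ne'
    field_simp
  calc N ^ (Fintype.card J + T) * Real.exp (-(Real.log N / ((N - 1) * N ^ Fintype.card J) * B))
      = N ^ T * (V * Real.exp (-(V⁻¹ * (Real.log N / (N - 1)) * B))) := by rw [hexpeq, hV]; ring
    _ ≤ N ^ T * ∑ v, a v := mul_le_mul_of_nonneg_left hexp (pow_pos hN0 T).le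
    _ = _ := hcount.symm

end Summit.PneNP.PneNP.Cruxes.SolvableImpliesStableSection.Sketch
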